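import Summits.BirchSwinnertonDyer.BirchSwinnertonDyer.Theorems.ErratumRoadFiveOpenInputIMCOfNormContinuity
import Literature.NumberTheory.EllipticCurves.BDPValueContinuityMultiplicativePrime
import HarnessLib

/-!
# Route `ErratumRoadFive` (K2 at `p ≥ 5`): (VN_p) at the erratum data DISCHARGED BY CITATION —
# Castella, J. Inst. Math. Jussieu 17 (2018) Thms. 2.10–2.11 (any conductor) — and the consequences:
# TARGET E ⟸ the value-free core alone; item 19061's glue needs NO H2 child; item 19275 ⟸ frames

Cell `bsd-stepL` (run/shared/lean/pub/bsd-stepL/), seat `bsd-stepL-bdp` (prover g11, 2026-08-26),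
`--supports stmt-BirchSwinnertonDyer-19275`. Third file of the (VN_p) series (p433271
`ErratumRoadFiveValueByNormContinuity`, p434829 `ErratumRoadFiveOpenInputIMCOfNormContinuity`).

The PUBLISHED named fact `castella2018Exceptional_bdpValueContinuity_trivialChar`
(`Literature/NumberTheory/EllipticCurves/BDPValueContinuityMultiplicativePrime.lean`: JIMJ18 Thms.
2.10–2.11 at weight two + BDP13 Prop. 5.10 + Cas18 Thm. 3.1's display ∕ proof of Thm. 3.2, in the
frame-free value-continuity currency, `p ≥ 5` multiplicative, ANY conductor, BDP13's Heegner hypothesis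
and auxiliary sign condition in tree form) is INSTANTIATED at every erratum datum of route R1: the
erratum field `K` for the non-split ramified `q` has `d_K` odd and `< −3` ([Cas20]'s standing
hypotheses), every `ℓ ∣ N_E` other than `q` split (so a prime dividing both `N_E` and `d_K` is `q`,
non-split multiplicative — the sign clause), `p` split, and `𝔭_{ι'}` is compatible with `ι'`.

## What this file proves (theorems only; no definition, no `sorry`; CONDITIONAL on the cited fact)

* `valueContinuityAtErratumData_of_castella2018Exceptional` ∕ `normContinuityAtErratumData_of_…`:
  the fact ⟹ (VC_p) ⟹ (VN_p) at the erratum data of every pair `(W, p)`.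
* `imcDivIntFrameAtErratumData_of_castella2018Exceptional_of_core`: TARGET E
  (`P2.IMCDivIntFrameAtErratumData W p`) ⟸ the fact + the value-free core
  `P2.IMCDivIntCoreFrameAtErratumData W p` — on ALL erratum data, semistable or not: the VALUE half of
  the erratum road is PUB-cited; only the divisibility (H3, item 19270, PREPRINT-derived) remains typed.
* **`openInputIMC_of_core_of_ramResidue_of_castella2018Exceptional_of_not_ram`**: the fact →
  `IMCDivAtErratumDataAll` (19270) → `OpenInputRamOffErratumLocus` (19274) → `OpenInputNotRam` (19282)
  → `PublishedInputsIMCReduction` (19283) → `OpenInputIMC` (19061): the crux's glue with the H2 child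
  19275 REPLACED by a published named fact.
* `bdpValueCoreFramesAll_of_castella2018Exceptional_of_frames`: item 19275 itself ⟸ the fact + frame
  existence at every erratum datum (H1∃⁻: Cas18 Thm. 3.1 on semistable pairs; memo THEOREM C♯ else).

HONEST FRAMING: CONDITIONAL on a cited PUBLISHED fact (flags in its docstring: the unit bookkeeping is
Castella 2018's printed dictionary; the sign clause is a root-number derivation) and on the OPEN
children; nothing is booked; no pair of class X11b is closed; no label or census count moves (T7).
-/

set_option autoImplicit false

noncomputable section

open scoped Classical Topology
open Filter WeierstrassCurve NumberField IsDedekindDomain Field PowerSeries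
open Literature.NumberTheory.EllipticCurves Literature.NumberTheory.EllipticCurves.GreenbergSelmer
open Literature.NumberTheory.EllipticCurves.ModularForms
open Literature.NumberTheory.EllipticCurves.Rank1Residual
open Literature.NumberTheory.EllipticCurves.Rank1Residual.Typed
open Literature.NumberTheory.EllipticCurves.Castella2018
open Literature.NumberTheory.GaloisRepresentations
open Literature.NumberTheory.GaloisCohomology
open Summit.BirchSwinnertonDyer.Rank1Residual Summit.BirchSwinnertonDyer.Rank1Residual.X11b
open Summit.BirchSwinnertonDyer.Rank1Residual.X11b.Halves
open Summit.BirchSwinnertonDyer.BirchSwinnertonDyer.Theses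

namespace Summit.BirchSwinnertonDyer.BirchSwinnertonDyer.Theorems

/-! ### §1 Pair level: the fact instantiated at the erratum data -/

section Pair

variable {W : WeierstrassCurve ℚ} [W.IsElliptic] [W.IsGloballyMinimal] {p : ℕ} [Fact p.Prime]

/-- **(VC_p) at the erratum data of `(W, p)` from the published fact.** The binders of the fact are
discharged at an erratum datum as in the module docstring: `5 ≤ p` and `p` multiplicative from
`ErratumHypotheses`; `d_K` odd and `< −3` from [Cas20]'s standing hypotheses; `p` split and the Heegner
clause from `IsErratumField`; the sign clause because a prime dividing both `N_E` and `d_K` cannot be a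
split prime of `K` (`not_dvd_discr_of_splitsIn`), hence is `q`, non-split multiplicative; `𝔭_{ι'}` is
compatible with `ι'` (`forall_mem_primeOfEmbeddingDatum_iff`). CONDITIONAL on the cited fact.
[cite: Castella2018Exceptional, Thms. 2.10–2.11 (arXiv:1507.04260 pp. 13–14)]
[cite: Castella2018, Thm. 3.1 (display) and proof of Thm. 3.2 (arXiv:1704.06608 p. 9)] -/
theorem valueContinuityAtErratumData_of_castella2018Exceptional
    (hF : castella2018Exceptional_bdpValueContinuity_trivialChar) :
    ∀ [NeZero (W.conductorNorm ℤ)] (q : ℕ) [Fact q.Prime] (K : Type) [Field K] [NumberField K]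
      (Dt : ModularParametrizationData W (W.conductorNorm ℤ))
      (H : HeegnerDatum (W.conductorNorm ℤ) (NumberField.discr K)) (w₀ : InfinitePlace K)
      (P : (W.baseChange K).toAffine.Point), ErratumHypotheses W p → W.analyticRank = 1 →
      q ≠ p → Mult W q → ¬ W.HasSplitMultiplicativeReductionAtPrime q →
      ¬ p ∣ padicValInt q W.minimalDiscriminantInt → IsErratumField W K q →
      Cas20Standing K p (W.conductorNorm ℤ / p) →
      WeierstrassCurve.Affine.Point.map w₀.embedding.toRatAlgHom P = heegnerPointComplex Dt H →
      ¬ (p : ℤ) ∣ Dt.c → ¬ IsOfFinAddOrder P →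
      ∀ (κ : ZpExtension K p), κ.IsAnticyclotomic →
        ∀ (γ : Field.absoluteGaloisGroup K) [Fact (κ.IsTopGenerator γ)] (ι' : PadicAlgCl p ≃+* ℂ)
          (e : K →+* ℚ_[p]),
          (∀ k : 𝓞 K, k ∈ (primeOfEmbeddingDatum p ι' w₀.embedding).asIdeal ↔ ‖e (k : K)‖ < 1) →
          ∃ (ΩK : ℂ) (Ωp : ℂ_[p]) (u : ℂ_[p]), ΩK ≠ 0 ∧ Ωp ≠ 0 ∧ ‖u‖ = 1 ∧
            ∀ (φ : ℕ → HeckeCharacter K) (n : ℕ → ℕ) (r : ℕ → FramedGaloisRep K (PadicAlgCl p) 1),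
              (∀ k, 0 < n k) → (∀ k (v : HeightOneSpectrum (𝓞 K)), (φ k).IsUnramifiedAt v) →
              (∀ k, (φ k).HasInfinityType (fun _ ↦ (n k : ℤ)) (fun _ ↦ -(n k : ℤ))) →
              (∀ k, IsPAdicAvatarOf ι' (φ k) (r k)) → (∀ k, FactorsThroughZp κ (r k)) →
              Tendsto (fun k ↦ avatarValueAt (r k) γ) atTop (𝓝 1) →
              Tendsto (fun k ↦ ((ι'.symm (bdpInterpolationValue p Dt.f
                  (primeOfEmbeddingDatum p ι' w₀.embedding) (φ k) (n k) ΩK) : PadicAlgCl p) : ℂ_[p]) *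
                Ωp ^ (4 * n k)) atTop
                (𝓝 (u * (algebraMap ℚ_[p] ℂ_[p] (((1 : ℚ_[p]) - ((W.LFunction p : ℤ) : ℚ_[p]) *
                  (p : ℚ_[p])⁻¹) * logOmega W p e P)) ^ 2)) := by
  intro _ q _ K _ _ Dt H w₀ P hE hr hqp hmq hns hvq hK hCas hP hc hinf κ hκ γ hγ ι' e he
  have hpN : p ∣ W.conductorNorm ℤ := dvd_conductorNorm_of_mult hE.2.1
  -- the sign clause: a prime dividing both `N_E` and `d_K` is `q`
  have hsign : ∀ (ℓ : ℕ) [Fact ℓ.Prime], ℓ ∣ W.conductorNorm ℤ → (ℓ : ℤ) ∣ NumberField.discr K →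
      W.HasMultiplicativeReductionAtPrime ℓ ∧ ¬ W.HasSplitMultiplicativeReductionAtPrime ℓ := by
    intro ℓ _ hℓN hℓD
    by_cases hℓq : ℓ = q
    · subst hℓq
      exact ⟨hmq, hns⟩
    · exact absurd hℓD (not_dvd_discr_of_splitsIn hK.1.1 Fact.out (hK.2.2.1 ℓ Fact.out hℓN hℓq))
  obtain ⟨ΩK, Ωp, u, hΩK, hΩp, hu, hcont⟩ :=
    hF ι' W K (primeOfEmbeddingDatum p ι' w₀.embedding) κ γ Dt H w₀ e P hE.1 rfl hE.2.1 hK.1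
      hCas.2.1 hCas.2.2.1 (hK.ncard_primesOver_eq_two Fact.out hpN hqp)
      (natCast_mem_primeOfEmbeddingDatum p ι' w₀.embedding)
      (forall_mem_primeOfEmbeddingDatum_iff p ι' hK.1 w₀) (hK.forall_exists_absNorm_eq Fact.out)
      (fun ℓ _ hℓN hℓD ↦ hsign ℓ hℓN hℓD) hκ hγ.out hc hP he
  refine ⟨ΩK, Ωp, u, hΩK, hΩp, hu, fun φ n r hn hunr hinf' hr' hrκ hlim ↦ ?_⟩
  rw [R1.logOmega_eq_padicLogOmega]
  exact hcont φ n r hn hunr hinf' hr' hrκ hlim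

/-- **(VN_p) at the erratum data of `(W, p)` from the published fact** ((VC_p) ⟹ (VN_p), p433271's
`normContinuityAtErratumData_of_valueContinuity`). CONDITIONAL on the cited fact.
[cite: Castella2018Exceptional, Thms. 2.10–2.11 (arXiv:1507.04260 pp. 13–14)] -/
theorem normContinuityAtErratumData_of_castella2018Exceptional
    (hF : castella2018Exceptional_bdpValueContinuity_trivialChar) :
    ∀ [NeZero (W.conductorNorm ℤ)] (q : ℕ) [Fact q.Prime] (K : Type) [Field K] [NumberField K]
      (Dt : ModularParametrizationData W (W.conductorNorm ℤ))
      (H : HeegnerDatum (W.conductorNorm ℤ) (NumberField.discr K)) (w₀ : InfinitePlace K)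
      (P : (W.baseChange K).toAffine.Point), ErratumHypotheses W p → W.analyticRank = 1 →
      q ≠ p → Mult W q → ¬ W.HasSplitMultiplicativeReductionAtPrime q →
      ¬ p ∣ padicValInt q W.minimalDiscriminantInt → IsErratumField W K q →
      Cas20Standing K p (W.conductorNorm ℤ / p) →
      WeierstrassCurve.Affine.Point.map w₀.embedding.toRatAlgHom P = heegnerPointComplex Dt H →
      ¬ (p : ℤ) ∣ Dt.c → ¬ IsOfFinAddOrder P →
      ∀ (κ : ZpExtension K p), κ.IsAnticyclotomic →
        ∀ (γ : Field.absoluteGaloisGroup K) [Fact (κ.IsTopGenerator γ)] (ι' : PadicAlgCl p ≃+* ℂ)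
          (e : K →+* ℚ_[p]),
          (∀ k : 𝓞 K, k ∈ (primeOfEmbeddingDatum p ι' w₀.embedding).asIdeal ↔ ‖e (k : K)‖ < 1) →
          ∃ (ΩK : ℂ) (Ωp : ℂ_[p]), ΩK ≠ 0 ∧ Ωp ≠ 0 ∧
            ∀ (φ : ℕ → HeckeCharacter K) (n : ℕ → ℕ) (r : ℕ → FramedGaloisRep K (PadicAlgCl p) 1),
              (∀ k, 0 < n k) → (∀ k (v : HeightOneSpectrum (𝓞 K)), (φ k).IsUnramifiedAt v) →
              (∀ k, (φ k).HasInfinityType (fun _ ↦ (n k : ℤ)) (fun _ ↦ -(n k : ℤ))) →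
              (∀ k, IsPAdicAvatarOf ι' (φ k) (r k)) → (∀ k, FactorsThroughZp κ (r k)) →
              Tendsto (fun k ↦ avatarValueAt (r k) γ) atTop (𝓝 1) →
              Tendsto (fun k ↦ ‖((ι'.symm (bdpInterpolationValue p Dt.f
                  (primeOfEmbeddingDatum p ι' w₀.embedding) (φ k) (n k) ΩK) : PadicAlgCl p) : ℂ_[p]) *
                Ωp ^ (4 * n k)‖) atTop
                (𝓝 (‖algebraMap ℚ_[p] ℂ_[p] (((1 : ℚ_[p]) - ((W.LFunction p : ℤ) : ℚ_[p]) *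
                  (p : ℚ_[p])⁻¹) * logOmega W p e P)‖ ^ 2)) :=
  normContinuityAtErratumData_of_valueContinuity (valueContinuityAtErratumData_of_castella2018Exceptional hF)

/-- **TARGET E from the published fact + the value-free core, on ALL erratum data (semistable or
not).** `P2.IMCDivIntFrameAtErratumData W p` ⟸ the fact + `P2.IMCDivIntCoreFrameAtErratumData W p`
(p433271's `imcDivIntFrameAtErratumData_of_normContinuity_of_core`). So on the erratum road the VALUE
half is PUB-cited and the only typed input left is the divisibility (H3). CONDITIONAL on the cited
fact and on the core shape (OPEN, PREPRINT-derived). [claim: Castella2018Erratum, status: under-review]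
[cite: Castella2018Exceptional, Thms. 2.10–2.11 (arXiv:1507.04260 pp. 13–14)] -/
theorem imcDivIntFrameAtErratumData_of_castella2018Exceptional_of_core
    (hF : castella2018Exceptional_bdpValueContinuity_trivialChar)
    (h : P2.IMCDivIntCoreFrameAtErratumData W p) : P2.IMCDivIntFrameAtErratumData W p :=
  imcDivIntFrameAtErratumData_of_normContinuity_of_core
    (normContinuityAtErratumData_of_castella2018Exceptional hF) h

end Pair

/-! ### §2 Route level -/

/-- **Item 19061's glue with the H2 child REPLACED by the published fact**: the fact →
`IMCDivAtErratumDataAll` (19270) → `OpenInputRamOffErratumLocus` (19274) → `OpenInputNotRam` (19282) →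
`PublishedInputsIMCReduction` (19283) → `OpenInputIMC` (p434829's
`openInputIMC_of_core_of_ramResidue_of_normContinuity_of_not_ram` with (VN_p ∀) supplied from print).
CONDITIONAL on the cited fact and the OPEN children; nothing booked.
[claim: Castella2018Erratum, status: under-review]
[cite: Castella2018Exceptional, Thms. 2.10–2.11 (arXiv:1507.04260 pp. 13–14)] [cite: Miller2011LMS, Def. 1.1] -/
theorem openInputIMC_of_core_of_ramResidue_of_castella2018Exceptional_of_not_ram
    (hF : castella2018Exceptional_bdpValueContinuity_trivialChar)
    (h3 : ErratumRoadFive.IMCDivAtErratumDataAll) (hRam : ErratumRoadFive.OpenInputRamOffErratumLocus)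
    (hOff : ErratumRoadFive.OpenInputNotRam) (hP : ErratumRoadFive.PublishedInputsIMCReduction) :
    ErratumRoadFive.OpenInputIMC :=
  openInputIMC_of_core_of_ramResidue_of_normContinuity_of_not_ram
    (fun W _ _ p _ ↦ normContinuityAtErratumData_of_castella2018Exceptional (W := W) (p := p) hF)
    h3 hRam hOff hP

/-- **Item 19275 from the published fact + frame existence (H1∃⁻ ∀)** (p434829's
`bdpValueCoreFramesAll_of_normContinuity_of_frames`). CONDITIONAL; nothing booked.
[cite: Castella2018Exceptional, Thms. 2.10–2.11 (arXiv:1507.04260 pp. 13–14)]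
[cite: Castella2018, Thm. 3.1, display (3.2) and Thm. 3.2 (arXiv:1704.06608 p. 9) (shapes only)] -/
theorem bdpValueCoreFramesAll_of_castella2018Exceptional_of_frames
    (hF : castella2018Exceptional_bdpValueContinuity_trivialChar)
    (hFr : ∀ (W : WeierstrassCurve ℚ) [W.IsElliptic] [W.IsGloballyMinimal] (p : ℕ) [Fact p.Prime],
      ∀ [NeZero (W.conductorNorm ℤ)] (q : ℕ) [Fact q.Prime] (K : Type) [Field K] [NumberField K]
      (Dt : ModularParametrizationData W (W.conductorNorm ℤ))
      (H : HeegnerDatum (W.conductorNorm ℤ) (NumberField.discr K)) (w₀ : InfinitePlace K)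
      (P : (W.baseChange K).toAffine.Point), ErratumHypotheses W p → W.analyticRank = 1 →
      q ≠ p → Mult W q → ¬ W.HasSplitMultiplicativeReductionAtPrime q →
      ¬ p ∣ padicValInt q W.minimalDiscriminantInt → IsErratumField W K q →
      Cas20Standing K p (W.conductorNorm ℤ / p) →
      WeierstrassCurve.Affine.Point.map w₀.embedding.toRatAlgHom P = heegnerPointComplex Dt H →
      ¬ (p : ℤ) ∣ Dt.c → ¬ IsOfFinAddOrder P →
      ∀ (κ : ZpExtension K p), κ.IsAnticyclotomic →
        ∀ (γ : Field.absoluteGaloisGroup K) [Fact (κ.IsTopGenerator γ)] (ι' : PadicAlgCl p ≃+* ℂ)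
          (e : K →+* ℚ_[p]),
          (∀ k : 𝓞 K, k ∈ (primeOfEmbeddingDatum p ι' w₀.embedding).asIdeal ↔ ‖e (k : K)‖ < 1) →
          ∃ (ΩK : ℂ) (Ωp : (unrIntegers p)ˣ) (L : UnrSeries p), ΩK ≠ 0 ∧
            IsBDPLFunction ι' (primeOfEmbeddingDatum p ι' w₀.embedding) κ γ Dt.f ΩK
              ((Ωp : unrIntegers p) : ℂ_[p]) L) :
    ErratumRoadFive.BDPValueCoreFramesAll :=
  bdpValueCoreFramesAll_of_normContinuity_of_frames
    (fun W _ _ p _ ↦ normContinuityAtErratumData_of_castella2018Exceptional (W := W) (p := p) hF) hFr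

end Summit.BirchSwinnertonDyer.BirchSwinnertonDyer.Theorems

end
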